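import Literature.Geometry.Riemannian.KernelGradientIntegralBound
import Literature.Geometry.Riemannian.KernelPotentialBounds
import HarnessLib

/-!
# The directional derivative of the pointed Nash entropy in its base point
# (Bamler 2020a, Thm. 5.9, gradient part, along curves)

R. Bamler, *Entropy and heat kernel bounds on a Ricci flow background*, arXiv:2008.07093 (2020a),
§5.1, Thm. 5.9 (arXiv v1: Thm. 19), first bound: if `R(·, s) ≥ R_min` then on `M × (s, ∞)`

  `|∇ 𝒩*_s| ≤ ( n/(2(t − s)) − R_min )^{1/2}`,

where `𝒩*_s(x, t) = 𝒩_{x,t}(t − s)` is the pointed Nash entropy of the conjugate heat kernel based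
at `(x, t)`, evaluated at time `s`. Bamler's proof (§5.3):
`∂ᵥ𝒩*_s(x,t) = ∫ (∂ᵥK/K)(f − 𝒩* − n/2) dν`
(because `∫ ∂ᵥK dg_s = ∂ᵥ 1 = 0`), then Cauchy–Schwarz with Prop. 4.2 (`(t−s)∫(∂ᵥK/K)² dν ≤ 1/2`)
and the potential bound `∫ (f − 𝒩 − n/2)² dν ≤ n − 2R_min(t − s)`.

This file PROVES the bound for the derivative ALONG A CURVE: for a Ricci flow on `[a, T]` of a
`C^∞` family of Riemannian metrics on a closed connected `M` modelled on `ℝᵐ` (`m ≥ 3`),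
`a < s < t < T`, and a `C^∞` curve `γ` with `g_t(γ̇(0), γ̇(0)) ≤ 1`,

* `IsRicciFlow.integral_deriv_heatKernelFn_curve_eq_zero` — `∫ ∂_σ|₀K(γσ,t;y,s) dg_s(y) = 0`;
* `IsRicciFlow.hasDerivAt_kernelNashEntropy_curve` — `σ ↦ 𝒩*_s(γ σ, t)` is differentiable at
  `0` with derivative `∫ −(log K + 1) ∂_σK dg_s` (differentiation under the integral sign,
  `hasDerivAt_setIntegral_comp_heatKernelFn_curve` with `Λ(k) = −k log k`);
* `IsRicciFlow.abs_deriv_kernelNashEntropy_curve_le` — **the bound**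
  `|d/dσ|₀ 𝒩*_s(γ σ, t)| ≤ (m/(2(t−s)) − R_min)^{1/2}`.

The Lipschitz estimate for `d_{g_t}` (integration along minimising geodesics) and the Laplacian
bounds `−n/(2(t−s)) ≤ □𝒩* ≤ 0` of Thm. 5.9 are NOT here.

## References

* R. H. Bamler, *Entropy and heat kernel bounds on a Ricci flow background*, arXiv:2008.07093
  (2020), §5.1 Thm. 5.9 (arXiv v1 Thm. 19), §5.3 (its proof). [Bamler2020Entropy]
-/

noncomputable section

open Set Filter Function MeasureTheory Measure
open scoped Manifold ContDiff Topology ENNReal NNReal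

namespace Literature.Geometry.Riemannian

open Lorentzian Lorentzian.PseudoRiemannianMetric

/-! ### An elementary Cauchy–Schwarz inequality for integrals -/

/-- **Cauchy–Schwarz from two quadratic bounds**: if `∫ A² ≤ P`, `∫ B² ≤ Q` (with `A², B², AB`
integrable) then `|∫ A B| ≤ √(P Q)` (from `2AB ≤ λA² + λ⁻¹B²` for every `λ > 0`). [folklore] -/
theorem abs_integral_mul_le_sqrt_mul_sqrt {X : Type*} [MeasurableSpace X] {μ : Measure X}
    {A B : X → ℝ} {P Q : ℝ} (hA : Integrable (fun y ↦ A y ^ 2) μ)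
    (hB : Integrable (fun y ↦ B y ^ 2) μ) (hAB : Integrable (fun y ↦ A y * B y) μ)
    (hP : ∫ y, A y ^ 2 ∂μ ≤ P) (hQ : ∫ y, B y ^ 2 ∂μ ≤ Q) :
    |∫ y, A y * B y ∂μ| ≤ Real.sqrt (P * Q) := by
  have hP0 : 0 ≤ P := (integral_nonneg fun y ↦ sq_nonneg (A y)).trans hP
  have hQ0 : 0 ≤ Q := (integral_nonneg fun y ↦ sq_nonneg (B y)).trans hQ
  -- the `λ`-inequality for `±A`
  have key : ∀ (ε : ℝ), ε = 1 ∨ ε = -1 → ∀ l : ℝ, 0 < l →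
      ε * ∫ y, A y * B y ∂μ ≤ (l * P + l⁻¹ * Q) / 2 := by
    intro ε hε l hl
    have hpt : ∀ y, ε * (A y * B y) ≤ (l * A y ^ 2 + l⁻¹ * B y ^ 2) / 2 := by
      intro y
      have key2 : 2 * l * (ε * (A y * B y)) ≤ l * (l * A y ^ 2) + B y ^ 2 := by
        rcases hε with rfl | rfl
        · nlinarith [sq_nonneg (l * A y - B y)]
        · nlinarith [sq_nonneg (l * A y + B y)]
      calc ε * (A y * B y) = (2 * l * (ε * (A y * B y))) / (2 * l) := by field_simp
        _ ≤ (l * (l * A y ^ 2) + B y ^ 2) / (2 * l) :=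
            div_le_div_of_nonneg_right key2 (by positivity)
        _ = (l * A y ^ 2 + l⁻¹ * B y ^ 2) / 2 := by field_simp
    calc ε * ∫ y, A y * B y ∂μ = ∫ y, ε * (A y * B y) ∂μ := (integral_const_mul _ _).symm
      _ ≤ ∫ y, (l * A y ^ 2 + l⁻¹ * B y ^ 2) / 2 ∂μ :=
          integral_mono (hAB.const_mul _) (((hA.const_mul _).add (hB.const_mul _)).div_const _)
            hpt
      _ = (l * ∫ y, A y ^ 2 ∂μ + l⁻¹ * ∫ y, B y ^ 2 ∂μ) / 2 := by
          rw [integral_div, integral_add (hA.const_mul _) (hB.const_mul _), integral_const_mul,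
            integral_const_mul]
      _ ≤ (l * P + l⁻¹ * Q) / 2 := by
          gcongr
  -- optimise in `λ`
  have bound : ∀ (ε : ℝ), ε = 1 ∨ ε = -1 → ε * ∫ y, A y * B y ∂μ ≤ Real.sqrt (P * Q) := by
    intro ε hε
    refine le_of_forall_pos_lt_add fun δ hδ ↦ ?_
    rcases hP0.eq_or_lt with hP0' | hPpos
    · -- `P = 0`: `ε ∫AB ≤ δ Q/(2(Q+1)) < δ`
      have h := key ε hε ((Q + 1) / δ) (by positivity)
      have hl : ((Q + 1) / δ)⁻¹ * Q = δ * (Q / (Q + 1)) := by rw [inv_div]; ring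
      have hQ1 : Q / (Q + 1) ≤ 1 := (div_le_one (by linarith)).2 (by linarith)
      rw [← hP0', mul_zero, zero_add, hl] at h
      rw [← hP0', zero_mul, Real.sqrt_zero, zero_add]
      nlinarith [mul_le_mul_of_nonneg_left hQ1 hδ.le]
    rcases hQ0.eq_or_lt with hQ0' | hQpos
    · -- `Q = 0`
      have h := key ε hε (δ / (P + 1)) (by positivity)
      have hl : δ / (P + 1) * P = δ * (P / (P + 1)) := by ring
      have hP1 : P / (P + 1) ≤ 1 := (div_le_one (by linarith)).2 (by linarith)
      rw [← hQ0', mul_zero, add_zero, hl] at h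
      rw [← hQ0', mul_zero, Real.sqrt_zero, zero_add]
      nlinarith [mul_le_mul_of_nonneg_left hP1 hδ.le]
    · -- `P, Q > 0`: `λ = √(Q/P)`
      set l : ℝ := Real.sqrt Q / Real.sqrt P with hl
      have hsP : 0 < Real.sqrt P := Real.sqrt_pos.2 hPpos
      have hsQ : 0 < Real.sqrt Q := Real.sqrt_pos.2 hQpos
      have hlpos : 0 < l := div_pos hsQ hsP
      have h := key ε hε l hlpos
      have eP : Real.sqrt P * Real.sqrt P = P := Real.mul_self_sqrt hP0
      have eQ : Real.sqrt Q * Real.sqrt Q = Q := Real.mul_self_sqrt hQ0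
      have e1 : l * P = Real.sqrt Q * Real.sqrt P := by
        rw [hl]
        calc Real.sqrt Q / Real.sqrt P * P
            = Real.sqrt Q / Real.sqrt P * (Real.sqrt P * Real.sqrt P) := by rw [eP]
          _ = Real.sqrt Q * Real.sqrt P := by field_simp
      have e2 : l⁻¹ * Q = Real.sqrt P * Real.sqrt Q := by
        rw [hl, inv_div]
        calc Real.sqrt P / Real.sqrt Q * Q
            = Real.sqrt P / Real.sqrt Q * (Real.sqrt Q * Real.sqrt Q) := by rw [eQ]
          _ = Real.sqrt P * Real.sqrt Q := by field_simp
      have e : (l * P + l⁻¹ * Q) / 2 = Real.sqrt (P * Q) := by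
        rw [e1, e2, Real.sqrt_mul hP0]
        ring
      linarith
  have h1 := bound 1 (Or.inl rfl)
  have h2 := bound (-1) (Or.inr rfl)
  rw [one_mul] at h1
  rw [neg_one_mul] at h2
  exact abs_le.2 ⟨by linarith, h1⟩

/-! ### The directional derivative of `𝒩*` along a curve -/

section Directional

variable {m : ℕ} {H : Type*} [TopologicalSpace H]
  {I : ModelWithCorners ℝ (EuclideanSpace ℝ (Fin m)) H} [I.Boundaryless]
  {M : Type*} [TopologicalSpace M] [ChartedSpace H M] [IsManifold I ∞ M]
  [T2Space M] [CompactSpace M] [SecondCountableTopology M] [MeasurableSpace M] [BorelSpace M]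
  [PreconnectedSpace M]
  {h : ℝ → PseudoRiemannianMetric I ∞ (EuclideanSpace ℝ (Fin m)) (TangentSpace I : M → Type _)}
  {cov : ℝ → CovariantDerivative I (EuclideanSpace ℝ (Fin m)) (TangentSpace I : M → Type _)}
  {a T : ℝ} (hflow : IsRicciFlow h cov (Icc a T)) (hh : IsContMDiffFamilyOn ∞ h univ)
  (hR : ∀ r, (h r).IsRiemannian)

/-- **`∫ ∂_σ|₀ K(γ(σ),t;y,s) dg_s(y) = 0`**: the mass `∫ K(x,t;y,s) dg_s(y) = 1` does not depend on
the base point (Bamler 2020a, §5.3: "`∫ ∂ᵥK(x,t;y,0) dg₀(y) = ∂ᵥ 1 = 0`").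
[cite: Bamler2020Entropy, §5.3, proof of Thm. 5.9] -/
theorem IsRicciFlow.integral_deriv_heatKernelFn_curve_eq_zero {s t : ℝ} (has : a < s)
    (hst : s < t) (htT : t < T) {γ : ℝ → M} (hγ : ContMDiff 𝓘(ℝ, ℝ) I ∞ γ) :
    ∫ y, deriv (fun σ ↦ hflow.heatKernelFn hh hR t (γ σ) (y, s)) 0 ∂(h s).riemVolume = 0 := by
  have ht : t ∈ Ioc a T := ⟨has.trans hst, htT.le⟩
  have hs : s ∈ Ioo a t := ⟨has, hst⟩
  have hD := hasDerivAt_setIntegral_comp_heatKernelFn_curve hflow hh hR has hst htT hγ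
    (Λ := fun k ↦ k) contDiffOn_id MeasurableSet.univ 0
  have hconst : (fun σ ↦ ∫ y in univ, (fun k : ℝ ↦ k) (hflow.heatKernelFn hh hR t (γ σ) (y, s))
      ∂(h s).riemVolume) = fun _ ↦ (1 : ℝ) := by
    funext σ
    rw [Measure.restrict_univ]
    exact hflow.integral_heatKernelFn_eq_one hh hR ht (γ σ) hs
  rw [hconst] at hD
  have h0 := hD.unique (hasDerivAt_const 0 (1 : ℝ))
  rw [Measure.restrict_univ] at h0
  have e : ∫ y, deriv (fun σ ↦ hflow.heatKernelFn hh hR t (γ σ) (y, s)) 0 ∂(h s).riemVolume =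
      ∫ y, deriv (fun k : ℝ ↦ k) (hflow.heatKernelFn hh hR t (γ 0) (y, s)) *
        deriv (fun σ ↦ hflow.heatKernelFn hh hR t (γ σ) (y, s)) 0 ∂(h s).riemVolume :=
    integral_congr_ae (Eventually.of_forall fun y ↦ by simp)
  rw [e]
  exact h0

/-- **The pointed Nash entropy is differentiable along a curve of base points**, with derivative
`∫ −(log K + 1) ∂_σ K dg_s` (differentiation under the integral for `Λ(k) = −k log k`, Bamler 2020a,
§5.3, first two displays). [cite: Bamler2020Entropy, §5.3, proof of Thm. 5.9] -/
theorem IsRicciFlow.hasDerivAt_kernelNashEntropy_curve {s t : ℝ} (has : a < s) (hst : s < t)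
    (htT : t < T) {γ : ℝ → M} (hγ : ContMDiff 𝓘(ℝ, ℝ) I ∞ γ) :
    HasDerivAt
      (fun σ ↦ pointedNashEntropy h (fun r y ↦ hflow.heatKernelFn hh hR t (γ σ) (y, r)) m t s)
      (∫ y, -(Real.log (hflow.heatKernelFn hh hR t (γ 0) (y, s)) + 1) *
        deriv (fun σ ↦ hflow.heatKernelFn hh hR t (γ σ) (y, s)) 0 ∂(h s).riemVolume) 0 := by
  have ht : t ∈ Ioc a T := ⟨has.trans hst, htT.le⟩
  have hs : s ∈ Ioo a t := ⟨has, hst⟩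
  -- `Λ(k) = −k log k` is `C¹` on `(0, ∞)` with `Λ'(k) = −(log k + 1)`
  have hΛ : ContDiffOn ℝ 1 (fun k : ℝ ↦ -(k * Real.log k)) (Ioi 0) :=
    (contDiffOn_id.mul (Real.contDiffOn_log.mono fun k hk ↦ ne_of_gt hk)).neg
  have hΛ' : ∀ k : ℝ, 0 < k → deriv (fun k : ℝ ↦ -(k * Real.log k)) k = -(Real.log k + 1) :=
    fun k hk ↦ (Real.hasDerivAt_mul_log hk.ne').neg.deriv
  have hD := hasDerivAt_setIntegral_comp_heatKernelFn_curve hflow hh hR has hst htT hγ hΛ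
    MeasurableSet.univ 0
  simp only [Measure.restrict_univ] at hD
  -- `𝒩*(γ σ) = ∫ Λ(K) − (m/2) log(4π(t−s)) − m/2`
  have hN : (fun σ ↦ pointedNashEntropy h (fun r y ↦ hflow.heatKernelFn hh hR t (γ σ) (y, r)) m t s)
      = fun σ ↦ (∫ y, -(hflow.heatKernelFn hh hR t (γ σ) (y, s) *
          Real.log (hflow.heatKernelFn hh hR t (γ σ) (y, s))) ∂(h s).riemVolume) -
        (m : ℝ) / 2 * Real.log (4 * Real.pi * (t - s)) - (m : ℝ) / 2 := by
    funext σ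
    exact hflow.kernelNashEntropy_eq hh hR ht (γ σ) hs
  rw [hN]
  refine ((hD.sub_const _).sub_const _).congr_deriv ?_
  refine integral_congr_ae (Eventually.of_forall fun y ↦ ?_)
  beta_reduce
  rw [hΛ' _ (hflow.heatKernelFn_pos hh hR ht (γ 0) ⟨mem_univ _, hs⟩)]

/-- **Bamler 2020a, Thm. 5.9, gradient bound, along a curve.** Let `hflow = (h, cov)` be a Ricci
flow on `[a, T]` of a `C^∞` family of Riemannian metrics on a closed connected manifold modelled on
`ℝᵐ`, `m ≥ 3`, `a < s < t < T`, `R(·, s) ≥ R_min`, and `γ` a `C^∞` curve with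
`g_t(γ̇(0), γ̇(0)) ≤ 1`. Then `σ ↦ 𝒩*_s(γ σ, t)` (the pointed Nash entropy of the conjugate heat
kernel based at `(γ σ, t)`, at time `s`) has at `σ = 0` a derivative of absolute value at most

  `( m/(2(t − s)) − R_min )^{1/2}`

("`|∇𝒩*_s| ≤ (n/(2(t−s)) − R_min)^{1/2}`"). Proof (§5.3): the derivative is
`∫ (∂K/K)(f − 𝒩* − m/2) dν` (`∫ ∂K dg_s = 0`), bounded by Cauchy–Schwarz with Prop. 4.2
(`mul_integral_sq_deriv_heatKernelFn_div_le`) and the potential bound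
`integral_sq_entropyPotential_sub_kernel_le`.
[cite: Bamler2020Entropy, §5.1, Thm. 5.9 (arXiv v1 Thm. 19), gradient bound] -/
theorem IsRicciFlow.abs_deriv_kernelNashEntropy_curve_le (hm : 3 ≤ m) {s t : ℝ} (has : a < s)
    (hst : s < t) (htT : t < T) {γ : ℝ → M} (hγ : ContMDiff 𝓘(ℝ, ℝ) I ∞ γ)
    (h1 : (h t).val (γ 0) (velocity I γ 0) (velocity I γ 0) ≤ 1) {Rmin : ℝ}
    (hRmin : ∀ y, Rmin ≤ (h s).scalarCurvatureWith (cov s) y) :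
    |deriv (fun σ ↦ pointedNashEntropy h
        (fun r y ↦ hflow.heatKernelFn hh hR t (γ σ) (y, r)) m t s) 0| ≤
      Real.sqrt ((m : ℝ) / (2 * (t - s)) - Rmin) := by
  haveI : IsFiniteMeasure (h s).riemVolume := ⟨(h s).riemVolume_univ_lt_top⟩
  have ht : t ∈ Ioc a T := ⟨has.trans hst, htT.le⟩
  have hs : s ∈ Ioo a t := ⟨has, hst⟩
  have hτ : 0 < t - s := sub_pos.2 hst
  set K₀ : M → ℝ := fun y ↦ hflow.heatKernelFn hh hR t (γ 0) (y, s) with hK₀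
  set K' : M → ℝ := fun y ↦ deriv (fun σ ↦ hflow.heatKernelFn hh hR t (γ σ) (y, s)) 0 with hK'
  set u : ℝ → M → ℝ := fun r y ↦ hflow.heatKernelFn hh hR t (γ 0) (y, r) with hu
  set f : M → ℝ := entropyPotential u m t s with hf
  set N : ℝ := pointedNashEntropy h u m t s with hNdef
  -- basic facts about `K₀`, `K'`, `f`
  have hK₀c : Continuous K₀ := hflow.continuous_heatKernelFn_slice hh hR ht (γ 0) hs
  have hK₀pos : ∀ y, 0 < K₀ y := fun y ↦ hflow.heatKernelFn_pos hh hR ht (γ 0) ⟨mem_univ _, hs⟩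
  have hK'm : Measurable K' := hflow.measurable_deriv_heatKernelFn_curve hh hR has hst htT hγ
  obtain ⟨B, hB⟩ := hflow.exists_abs_deriv_heatKernelFn_curve_le hh hR has hst htT hγ
  have hus : ContMDiff I 𝓘(ℝ, ℝ) ∞ (u s) := hflow.contMDiff_heatKernelFn_slice hh hR ht (γ 0) hs
  have hfs : ContMDiff I 𝓘(ℝ, ℝ) ∞ f := contMDiff_neg_log_sub hus hK₀pos _
  have hfc : Continuous f := hfs.continuous
  obtain ⟨k₀, hk₀pos, hk₀⟩ : ∃ k₀ : ℝ, 0 < k₀ ∧ ∀ y, k₀ ≤ K₀ y := by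
    rcases isEmpty_or_nonempty M with hM | hM
    · exact ⟨1, one_pos, fun y ↦ (IsEmpty.false y).elim⟩
    · obtain ⟨y₀, -, hy₀⟩ := isCompact_univ.exists_isMinOn univ_nonempty hK₀c.continuousOn
      exact ⟨K₀ y₀, hK₀pos y₀, fun y ↦ hy₀ (mem_univ y)⟩
  obtain ⟨Cf, hCf⟩ : ∃ C, ∀ y, |f y| ≤ C := by
    rcases isEmpty_or_nonempty M with hM | hM
    · exact ⟨0, fun y ↦ (IsEmpty.false y).elim⟩
    · obtain ⟨C, hC⟩ :=
        isCompact_univ.exists_bound_of_continuousOn (continuous_abs.comp hfc).continuousOn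
      exact ⟨C, fun y ↦ by simpa using hC y (mem_univ y)⟩
  have hi : ∀ {φ : M → ℝ}, Continuous φ → Integrable φ (h s).riemVolume := fun hφ ↦
    hφ.integrable_of_hasCompactSupport (HasCompactSupport.of_compactSpace _)
  have hbi : ∀ {φ : M → ℝ}, Measurable φ → (∃ C, ∀ y, |φ y| ≤ C) → Integrable φ (h s).riemVolume :=
    fun hφ ⟨C, hC⟩ ↦ Integrable.of_bound hφ.aestronglyMeasurable C
      (ae_of_all _ fun y ↦ by rw [Real.norm_eq_abs]; exact hC y)
  -- the derivative and its re-centred form `∫ (f − N − m/2) K' dg_s`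
  have hderiv := hflow.hasDerivAt_kernelNashEntropy_curve hh hR has hst htT hγ
  rw [hderiv.deriv]
  have hK'i : Integrable K' (h s).riemVolume := hbi hK'm ⟨B, hB⟩
  have h0 : ∫ y, K' y ∂(h s).riemVolume = 0 :=
    hflow.integral_deriv_heatKernelFn_curve_eq_zero hh hR has hst htT hγ
  have hfK'i : Integrable (fun y ↦ f y * K' y) (h s).riemVolume := by
    refine hbi (hfc.measurable.mul hK'm) ⟨Cf * B, fun y ↦ ?_⟩
    rw [abs_mul]
    exact mul_le_mul (hCf y) (hB y) (abs_nonneg _) ((abs_nonneg _).trans (hCf y))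
  have hrecentre : ∫ y, -(Real.log (K₀ y) + 1) * K' y ∂(h s).riemVolume =
      ∫ y, (f y - (N + (m : ℝ) / 2)) * K' y ∂(h s).riemVolume := by
    have e1 : ∀ y, -(Real.log (K₀ y) + 1) * K' y =
        f y * K' y + ((m : ℝ) / 2 * Real.log (4 * Real.pi * (t - s)) - 1) * K' y := fun y ↦ by
      simp only [hf, entropyPotential_apply, hu]
      ring
    have e2 : ∀ y, (f y - (N + (m : ℝ) / 2)) * K' y = f y * K' y + (-(N + (m : ℝ) / 2)) * K' y :=
      fun y ↦ by ring
    simp_rw [e1, e2]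
    rw [integral_add hfK'i (hK'i.const_mul _), integral_add hfK'i (hK'i.const_mul _),
      integral_const_mul, integral_const_mul, h0, mul_zero, mul_zero]
  rw [show (fun y ↦ -(Real.log (hflow.heatKernelFn hh hR t (γ 0) (y, s)) + 1) *
      deriv (fun σ ↦ hflow.heatKernelFn hh hR t (γ σ) (y, s)) 0) =
      fun y ↦ -(Real.log (K₀ y) + 1) * K' y from rfl, hrecentre]
  -- Cauchy–Schwarz with `A = (f − N − m/2) √K₀`, `B = (K'/K₀) √K₀`
  set A : M → ℝ := fun y ↦ (f y - (N + (m : ℝ) / 2)) * Real.sqrt (K₀ y) with hA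
  set Bf : M → ℝ := fun y ↦ K' y / K₀ y * Real.sqrt (K₀ y) with hBf
  have hsq : ∀ y, Real.sqrt (K₀ y) * Real.sqrt (K₀ y) = K₀ y := fun y ↦
    Real.mul_self_sqrt (hK₀pos y).le
  have hABeq : ∀ y, A y * Bf y = (f y - (N + (m : ℝ) / 2)) * K' y := fun y ↦ by
    simp only [hA, hBf]
    have hne := (hK₀pos y).ne'
    calc (f y - (N + (m : ℝ) / 2)) * Real.sqrt (K₀ y) * (K' y / K₀ y * Real.sqrt (K₀ y))
        = (f y - (N + (m : ℝ) / 2)) * K' y * (Real.sqrt (K₀ y) * Real.sqrt (K₀ y) / K₀ y) := by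
          ring
      _ = (f y - (N + (m : ℝ) / 2)) * K' y := by rw [hsq y, div_self hne, mul_one]
  have hA2eq : ∀ y, A y ^ 2 = (f y - (N + (m : ℝ) / 2)) ^ 2 * K₀ y := fun y ↦ by
    simp only [hA]; rw [mul_pow, Real.sq_sqrt (hK₀pos y).le]
  have hB2eq : ∀ y, Bf y ^ 2 = (K' y / K₀ y) ^ 2 * K₀ y := fun y ↦ by
    simp only [hBf]; rw [mul_pow, Real.sq_sqrt (hK₀pos y).le]
  -- integrability
  have hA2i : Integrable (fun y ↦ A y ^ 2) (h s).riemVolume := by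
    simp_rw [hA2eq]
    exact hi (((hfc.sub continuous_const).pow 2).mul hK₀c)
  have hq_bdd : ∀ y, |K' y / K₀ y| ≤ B / k₀ := fun y ↦ by
    rw [abs_div, abs_of_pos (hK₀pos y)]
    exact div_le_div₀ ((abs_nonneg _).trans (hB y)) (hB y) hk₀pos (hk₀ y)
  have hB2i : Integrable (fun y ↦ Bf y ^ 2) (h s).riemVolume := by
    simp_rw [hB2eq]
    refine hbi (((hK'm.div hK₀c.measurable).pow_const 2).mul hK₀c.measurable) ?_
    obtain ⟨CK, hCK⟩ := isCompact_univ.bddAbove_image hK₀c.continuousOn |>.exists_ge 0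
    refine ⟨(B / k₀) ^ 2 * CK, fun y ↦ ?_⟩
    rw [abs_mul, abs_of_pos (hK₀pos y), abs_pow]
    refine mul_le_mul (pow_le_pow_left₀ (abs_nonneg _) (hq_bdd y) 2) ?_ (hK₀pos y).le
      (by positivity)
    exact hCK.2 _ ⟨y, mem_univ _, rfl⟩
  have hABi : Integrable (fun y ↦ A y * Bf y) (h s).riemVolume := by
    simp_rw [hABeq]
    exact hbi ((hfc.sub continuous_const).measurable.mul hK'm) ⟨(Cf + |N + (m : ℝ) / 2|) * B,
      fun y ↦ by
        rw [abs_mul]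
        refine mul_le_mul ((abs_sub _ _).trans (add_le_add (hCf y) le_rfl)) (hB y)
          (abs_nonneg _) (add_nonneg ((abs_nonneg _).trans (hCf y)) (abs_nonneg _))⟩
  -- the two quadratic bounds
  have hP : ∫ y, A y ^ 2 ∂(h s).riemVolume ≤ (m : ℝ) - 2 * Rmin * (t - s) := by
    simp_rw [hA2eq]
    exact hflow.integral_sq_entropyPotential_sub_kernel_le hh hR hm ht (γ 0) hs hRmin
  have hQ : ∫ y, Bf y ^ 2 ∂(h s).riemVolume ≤ 1 / (2 * (t - s)) := by
    simp_rw [hB2eq]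
    have h42 := hflow.mul_integral_sq_deriv_heatKernelFn_div_le hh hR has hst htT hγ h1
    rw [hflow.integral_heatKernelMeasure_eq_integral_mul_heatKernelFn hh hR ht (γ 0) hs] at h42
    rw [le_div_iff₀ (by positivity)]
    calc (∫ y, (K' y / K₀ y) ^ 2 * K₀ y ∂(h s).riemVolume) * (2 * (t - s))
        = 2 * ((t - s) * ∫ y, (K' y / K₀ y) ^ 2 * K₀ y ∂(h s).riemVolume) := by ring
      _ ≤ 2 * (1 / 2) := by gcongr
      _ = 1 := by norm_num
  have hCS := abs_integral_mul_le_sqrt_mul_sqrt hA2i hB2i hABi hP hQ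
  simp_rw [hABeq] at hCS
  refine hCS.trans (le_of_eq ?_)
  congr 1
  field_simp

end Directional

end Literature.Geometry.Riemannian

end
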